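import Summits.HodgeConjecture.HodgeConjecture.Theorems.R90S9HlocRecordSCDOfHQS          -- ★ p865005 (this seat): `aPacketsOfRecordDisjointAt_recordSCD_of_hQS_of_carrierLaws` (row 25 with `hloc` paid); brings ★ p864969 §4 `eq_packagePis_pair_of_xiLocalChar_eq`
import Summits.HodgeConjecture.HodgeConjecture.Theorems.F0P3cDbTKeysLabelRigidity         -- ★ `comap_keysLabelCM_eq` (the transported Keys label `πⁿ ∘ e` is frame independent)
import Summits.HodgeConjecture.HodgeConjecture.Theorems.F0P3XiLocalCharOpenKernel         -- ★ `isOpen_ker_xiLocalChar` (`ξ_v` has open kernel, so `ℂ_{ξ_v}` is a smooth irreducible)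
import Literature.NumberTheory.Automorphic.SmoothCharacterOfCharacter                     -- ★ `SmoothIrrep.ofChar`, `eq_of_mk_ofChar_eq`, `eq_of_singleton_mk_ofChar_eq` (`⟦ℂ_χ⟧ ↦ χ` injective)
import HarnessLib

/-!
# R90-TF · S9 «InnerForm-13.3.6 (c)» — THE DICTIONARY ROW JQ-S9-S4-7 OF `sock_S9_aPacketsDisjointNonsplit_cm`, REDUCED: `hα ∕ hγ` BY TRANSPORT, `hdict` FROM (J1) (J2)

Cell `hodgecm-mathlib`, crux H413 (`stmt-HodgeConjecture-24833`, lane `--supports … --as helper`), route of record `HCCMUnconditional` (no route verbs; count-neutral).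
Programme R90-TF (HUMAN RULING «R90-TF SLAB — MAX PUSH»; brief `director/R90-BRIEF.v2.md` 1f40d54518340a35), section S9 = InnerForm-13.3.6 (c) (base `R90-IF`); seat
R90-IF-p03 (g4); dealer R90-IF-plan (g2) DEAL 2026-09-05T03:23:13Z (f3) «JQ-S9-S4-7 junction probe» (HOME `R90/R90-IF-p03/g4/PROBE-JQ-S9-S4-7.lean` 8a6c6bc8) and RULING
03:31:26Z «GO (f4): land the reduction».  THEOREMS ONLY: no `def`, no instance, no notation, no named fact, no `sorry`; imports ★ only; X-generic (S4's fibres `fib` and B's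
pins `supp`, `T₀` are PARAMETERS; no `Lines`, no S4 module).  HONEST LABEL: HC_CM is proved only modulo the 7 printed citations (2 remaining named inputs: hLiu418 =
stmt-HodgeConjecture-24832, h413 = stmt-HodgeConjecture-24833) — until rung 0 closes.  Reductions over hypotheses; (J1) (J2) and the fibre laws are S4-OWNED letters
(A ED. 6, junction ask JQ-S9-S4-7 v2, R90 bus 03:31:26Z); nothing printed is paid here.

## The junction [Rogawski1990, §13.1 p. 199 l. 14–18, Prop. 13.1.3 (d), Prop. 13.1.4; §12.2 (2) pp. 173–174]
★ p865005 `aPacketsOfRecordDisjointAt_recordSCD_of_hQS_of_carrierLaws` closes FILE B's row-30 socket from: per-place carrier supports `supp v ξ ⊆ Irr(U(H)(L⁺_v))`, a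
supercuspidality predicate, the DICTIONARY `hdict` (both slots of the record packet `Ξ₀ ξ v` lie in `supp v ξ`) and S4's laws `hα` ∕ `hγ` (a common non-supercuspidal ∕
supercuspidal class of `supp v ξ`, `supp v ξ′` forces `ξ_v = ξ′_v`).  S4 (A ED. 5∕6, `Lines/R90_S4_LocalKitExportA`) speaks on the QUASI-SPLIT group `U(Φ₃)(L⁺_v) = Gqs L v`
(`(cmDatum L 3 (splitForm L 3)).Local v = Gqs L v` by `rfl`) about FIBRES of one-dimensional carriers `{⟦ℂ_χ⟧}`, `χ` a LOCAL character of `H_v` (LC-OVERLAP: a common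
non-supercuspidal class ⇒ equal fibre supports; LC-XIFIB: equal supports ⇒ `{⟦ℂ_χ⟧} = {⟦ℂ_χ′⟧}`; LC-ADISJ-SC: the supercuspidal twin).  This file is the S9-side glue:
* §1 `fibreLaw_transport` — generic: a fibre law survives transport along an injective map respecting the supercuspidality predicates.
* §2 B's pin `supp v ξ := IrrClass.comap e.symm '' fib v (ξ.xiLocalChar v)` for ANY `e : Gqs L v ≃ₜ* U(H)(L⁺_v)`, `IsSC := IrrClass.IsSupercuspidal`:
  `carrierLaw_nonsc_of_fibreLaw` ∕ `carrierLaw_sc_of_fibreLaw` (laws stated per LOCAL CHARACTER, conclusion `χ = χ′`) and `carrierLaw_nonsc_of_fibreLawSingleton` ∕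
  `carrierLaw_sc_of_fibreLawSingleton` (laws in S4's native SINGLETON-CARRIER currency, conclusion `{⟦ℂ_χ⟧} = {⟦ℂ_χ′⟧}`; the class-to-character step (m1) is ★
  `eq_of_singleton_mk_ofChar_eq` + ★ `isOpen_ker_xiLocalChar`) ⊢ ★ p865005's `hα` ∕ `hγ` VERBATIM (★ `comap_comap_symm` injectivity, ★ `isSupercuspidal_comap_iff`).
* §3 `hdict_recordSCD_of_slotsInFibre` — at the pinned record and ONE fixed frame per non-split place, `hdict` from (J1) «Keys' `πⁿ` label ∈ fibre» + (J2) «the signed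
  supercuspidal partner at the fixed frame, pulled back, ∈ fibre»; the record's hidden frame is eliminated by ★ `comap_keysLabelCM_eq` + ★ p864969 §4.
ED. 6 then reads `hdict := hdict_recordSCD_of_slotsInFibre … hJ1 hJ2`, `hα := carrierLaw_nonsc_of_fibreLaw[Singleton] … hα⁺`, `hγ := carrierLaw_sc_of_fibreLaw[Singleton] … hγ⁺`.

## References
* [Rogawski1990] J. D. Rogawski, *Automorphic Representations of Unitary Groups in Three Variables*, Ann. of Math. Stud. 123 (1990): §13.1 p. 199 l. 14–18,
  Prop. 13.1.2 (c) p. 198, Prop. 13.1.3 (d), Prop. 13.1.4 p. 199; §12.2 (2) pp. 173–174; §12.1 p. 171; §14.2 p. 234.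
* [BushnellHenniart2006] C. Bushnell, G. Henniart, *The Local Langlands Conjecture for `GL(2)`*, Grundlehren 335 (2006): §1.1, §1.5, §10.1.
-/

set_option autoImplicit false
-- the mandated namespace repeats `HodgeConjecture.HodgeConjecture`, as in every `Theorems/*.lean` of this sub-problem
set_option linter.dupNamespace false

noncomputable section

open NumberField IsDedekindDomain MeasureTheory
open scoped Matrix
open Literature.NumberTheory Literature.NumberTheory.Automorphic Literature.NumberTheory.Automorphic.UnitaryGroup
open Literature.NumberTheory.Automorphic.IdeleClassGroup Literature.NumberTheory.GaloisRepresentations Literature.NumberTheory.Rogawski1990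
open Summit.HodgeConjecture.HodgeConjecture.Cruxes.H413
open Summit.HodgeConjecture.HodgeConjecture.Cruxes.H413.F0P3XiPacketFamilyOfRecordSCD

namespace Summit.HodgeConjecture.HodgeConjecture.R90.S9

/-! ## §1 Generic: a fibre law survives transport along an injective map respecting supercuspidality -/

/-- **Transport of a fibre law.**  `f : B → A` injective with `scA (f b) ↔ scB b`, fibres `fib : C → Set B`, local data `loc : I → C`, and a law «`b ∈ fib χ ∩ fib χ′`
with `P (scB b)` forces `χ = χ′`» (`P = Not` resp. `P = id` for the non-supercuspidal resp. supercuspidal law): then «`a ∈ f '' fib (loc i) ∩ f '' fib (loc j)` with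
`P (scA a)` forces `loc i = loc j`».  Pure logic. [cite: BushnellHenniart2006, §1.1] [folklore] -/
theorem fibreLaw_transport {I A B C : Type*} (f : B → A) (hf : Function.Injective f) (scA : A → Prop) (scB : B → Prop)
    (hsc : ∀ b, scA (f b) ↔ scB b) (fib : C → Set B) (loc : I → C) (P : Prop → Prop)
    (hlaw : ∀ χ χ' b, b ∈ fib χ → b ∈ fib χ' → P (scB b) → χ = χ')
    (i j : I) (a : A) (hi : a ∈ f '' fib (loc i)) (hj : a ∈ f '' fib (loc j)) (ha : P (scA a)) : loc i = loc j := by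
  obtain ⟨b, hb, rfl⟩ := hi
  obtain ⟨b', hb', hbb⟩ := hj
  cases hf hbb
  exact hlaw _ _ b hb hb' (by simpa only [hsc] using ha)

/-! ## §2 B's pin `supp v ξ := comap e.symm '' fib v (ξ_v)`: S4's fibre laws on `U(Φ₃)(L⁺_v)` ⟹ ★ p865005's `hα` ∕ `hγ` -/

section Laws

variable (L : Type) [Field L] [NumberField L] [IsCMField L] (H : Matrix (Fin 3) (Fin 3) L)
  (v : HeightOneSpectrum (𝓞 ↥(maximalRealSubfield L))) (e : Gqs L v ≃ₜ* (cmDatum L 3 H).Local v)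
  (fib : ((cmDatum L 2 (Matrix.of fun i j : Fin 2 => if i.val + j.val + 1 = 2 then (1 : L) else 0)).Local v ×
      (cmDatum L 1 (Matrix.of fun i j : Fin 1 => if i.val + j.val + 1 = 1 then (1 : L) else 0)).Local v →* ℂˣ) → Set (IrrClass (Gqs L v)))

/-- **(α) PER LOCAL CHARACTER ⟹ `hα`.**  If a NON-supercuspidal class common to the fibres of `ℂ_χ` and `ℂ_χ′` forces `χ = χ′` (S4: LC-OVERLAP + LC-XIFIB + class
injectivity; Rogawski §12.2 (2): `πⁿ(ξ_v)` determines `ξ_v`), then — at the pin `supp v ξ := comap e.symm '' fib v (ξ_v)` for ANY `e : U(Φ₃)(L⁺_v) ≃ₜ* U(H)(L⁺_v)` — a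
non-supercuspidal class common to `supp v ξ`, `supp v ξ′` forces `ξ.xiLocalChar v = ξ′.xiLocalChar v` (★ `comap_comap_symm`, ★ `isSupercuspidal_comap_iff`).
[cite: Rogawski1990, §12.2 (2) pp. 173–174; §13.1 p. 199] [cite: BushnellHenniart2006, §1.1, §10.1] -/
theorem carrierLaw_nonsc_of_fibreLaw (hα' : ∀ χ χ' π, π ∈ fib χ → π ∈ fib χ' → ¬ π.IsSupercuspidal → χ = χ') :
    ∀ (ξ ξ' : OneDimAutRepH L) (a : IrrClass ((cmDatum L 3 H).Local v)),
      a ∈ IrrClass.comap e.symm '' fib (ξ.xiLocalChar v) → a ∈ IrrClass.comap e.symm '' fib (ξ'.xiLocalChar v) → ¬ a.IsSupercuspidal →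
        ξ.xiLocalChar v = ξ'.xiLocalChar v :=
  fun ξ ξ' a hi hj ha => fibreLaw_transport (IrrClass.comap e.symm) (fun b b' h => by simpa only [IrrClass.comap_comap_symm] using congrArg (IrrClass.comap e) h)
    IrrClass.IsSupercuspidal IrrClass.IsSupercuspidal (fun b => IrrClass.isSupercuspidal_comap_iff e.symm b) fib (fun ξ : OneDimAutRepH L => ξ.xiLocalChar v) Not
    hα' ξ ξ' a hi hj ha

/-- **(γ) PER LOCAL CHARACTER ⟹ `hγ`** (the supercuspidal twin: S4's LC-ADISJ-SC; Prop. 13.1.3 (d)). [cite: Rogawski1990, §13.1 Prop. 13.1.3 (d), Prop. 13.1.2 (c) pp. 198–199]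
[cite: BushnellHenniart2006, §1.1, §10.1] -/
theorem carrierLaw_sc_of_fibreLaw (hγ' : ∀ χ χ' π, π ∈ fib χ → π ∈ fib χ' → π.IsSupercuspidal → χ = χ') :
    ∀ (ξ ξ' : OneDimAutRepH L) (a : IrrClass ((cmDatum L 3 H).Local v)),
      a ∈ IrrClass.comap e.symm '' fib (ξ.xiLocalChar v) → a ∈ IrrClass.comap e.symm '' fib (ξ'.xiLocalChar v) → a.IsSupercuspidal →
        ξ.xiLocalChar v = ξ'.xiLocalChar v :=
  fun ξ ξ' a hi hj ha => fibreLaw_transport (IrrClass.comap e.symm) (fun b b' h => by simpa only [IrrClass.comap_comap_symm] using congrArg (IrrClass.comap e) h)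
    IrrClass.IsSupercuspidal IrrClass.IsSupercuspidal (fun b => IrrClass.isSupercuspidal_comap_iff e.symm b) fib (fun ξ : OneDimAutRepH L => ξ.xiLocalChar v) id
    hγ' ξ ξ' a hi hj ha

/-- **(α) IN S4's SINGLETON-CARRIER CURRENCY ⟹ `hα`.**  S4's LC-OVERLAP + LC-XIFIB conclude an equality of one-dimensional CARRIERS `{⟦ℂ_χ⟧} = {⟦ℂ_χ′⟧}` (finsets of
classes of `H_v`); the passage to `χ = χ′` is ★ `eq_of_singleton_mk_ofChar_eq` («`⟦ℂ_χ⟧` determines `χ`», §12.1 type (3)) at the open kernels ★ `isOpen_ker_xiLocalChar`.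
[cite: Rogawski1990, §12.1 p. 171; §12.2 (2) pp. 173–174; §13.1 p. 199] [cite: BushnellHenniart2006, §1.1, §1.5] -/
theorem carrierLaw_nonsc_of_fibreLawSingleton
    (hα' : ∀ χ χ'
      (hχ : IsOpen ((χ.ker : Subgroup ((cmDatum L 2 (Matrix.of fun i j : Fin 2 => if i.val + j.val + 1 = 2 then (1 : L) else 0)).Local v ×
        (cmDatum L 1 (Matrix.of fun i j : Fin 1 => if i.val + j.val + 1 = 1 then (1 : L) else 0)).Local v)) :
        Set ((cmDatum L 2 (Matrix.of fun i j : Fin 2 => if i.val + j.val + 1 = 2 then (1 : L) else 0)).Local v ×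
          (cmDatum L 1 (Matrix.of fun i j : Fin 1 => if i.val + j.val + 1 = 1 then (1 : L) else 0)).Local v)))
      (hχ' : IsOpen ((χ'.ker : Subgroup ((cmDatum L 2 (Matrix.of fun i j : Fin 2 => if i.val + j.val + 1 = 2 then (1 : L) else 0)).Local v ×
        (cmDatum L 1 (Matrix.of fun i j : Fin 1 => if i.val + j.val + 1 = 1 then (1 : L) else 0)).Local v)) :
        Set ((cmDatum L 2 (Matrix.of fun i j : Fin 2 => if i.val + j.val + 1 = 2 then (1 : L) else 0)).Local v ×
          (cmDatum L 1 (Matrix.of fun i j : Fin 1 => if i.val + j.val + 1 = 1 then (1 : L) else 0)).Local v))) π,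
      π ∈ fib χ → π ∈ fib χ' → ¬ π.IsSupercuspidal →
        ({IrrClass.mk (SmoothIrrep.ofChar χ hχ)} : Finset (IrrClass ((cmDatum L 2 (Matrix.of fun i j : Fin 2 => if i.val + j.val + 1 = 2 then (1 : L) else 0)).Local v ×
          (cmDatum L 1 (Matrix.of fun i j : Fin 1 => if i.val + j.val + 1 = 1 then (1 : L) else 0)).Local v))) =
          {IrrClass.mk (SmoothIrrep.ofChar χ' hχ')}) :
    ∀ (ξ ξ' : OneDimAutRepH L) (a : IrrClass ((cmDatum L 3 H).Local v)),
      a ∈ IrrClass.comap e.symm '' fib (ξ.xiLocalChar v) → a ∈ IrrClass.comap e.symm '' fib (ξ'.xiLocalChar v) → ¬ a.IsSupercuspidal →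
        ξ.xiLocalChar v = ξ'.xiLocalChar v := by
  intro ξ ξ' a hi hj ha
  obtain ⟨b, hb, rfl⟩ := hi
  obtain ⟨b', hb', hbb⟩ := hj
  cases (fun h => by simpa only [IrrClass.comap_comap_symm] using congrArg (IrrClass.comap e) h : ∀ {x y}, IrrClass.comap e.symm x = IrrClass.comap e.symm y → x = y) hbb
  exact eq_of_singleton_mk_ofChar_eq _ _ (hα' _ _ (F0P3XiLocalCharOpenKernel.isOpen_ker_xiLocalChar L ξ v)
    (F0P3XiLocalCharOpenKernel.isOpen_ker_xiLocalChar L ξ' v) b hb hb' ((IrrClass.isSupercuspidal_comap_iff e.symm b).not.1 ha))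

/-- **(γ) IN S4's SINGLETON-CARRIER CURRENCY ⟹ `hγ`** (LC-ADISJ-SC's literal output). [cite: Rogawski1990, §13.1 Prop. 13.1.3 (d), Prop. 13.1.2 (c) pp. 198–199; §12.1 p. 171]
[cite: BushnellHenniart2006, §1.1, §1.5] -/
theorem carrierLaw_sc_of_fibreLawSingleton
    (hγ' : ∀ χ χ'
      (hχ : IsOpen ((χ.ker : Subgroup ((cmDatum L 2 (Matrix.of fun i j : Fin 2 => if i.val + j.val + 1 = 2 then (1 : L) else 0)).Local v ×
        (cmDatum L 1 (Matrix.of fun i j : Fin 1 => if i.val + j.val + 1 = 1 then (1 : L) else 0)).Local v)) :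
        Set ((cmDatum L 2 (Matrix.of fun i j : Fin 2 => if i.val + j.val + 1 = 2 then (1 : L) else 0)).Local v ×
          (cmDatum L 1 (Matrix.of fun i j : Fin 1 => if i.val + j.val + 1 = 1 then (1 : L) else 0)).Local v)))
      (hχ' : IsOpen ((χ'.ker : Subgroup ((cmDatum L 2 (Matrix.of fun i j : Fin 2 => if i.val + j.val + 1 = 2 then (1 : L) else 0)).Local v ×
        (cmDatum L 1 (Matrix.of fun i j : Fin 1 => if i.val + j.val + 1 = 1 then (1 : L) else 0)).Local v)) :
        Set ((cmDatum L 2 (Matrix.of fun i j : Fin 2 => if i.val + j.val + 1 = 2 then (1 : L) else 0)).Local v ×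
          (cmDatum L 1 (Matrix.of fun i j : Fin 1 => if i.val + j.val + 1 = 1 then (1 : L) else 0)).Local v))) π,
      π ∈ fib χ → π ∈ fib χ' → π.IsSupercuspidal →
        ({IrrClass.mk (SmoothIrrep.ofChar χ hχ)} : Finset (IrrClass ((cmDatum L 2 (Matrix.of fun i j : Fin 2 => if i.val + j.val + 1 = 2 then (1 : L) else 0)).Local v ×
          (cmDatum L 1 (Matrix.of fun i j : Fin 1 => if i.val + j.val + 1 = 1 then (1 : L) else 0)).Local v))) =
          {IrrClass.mk (SmoothIrrep.ofChar χ' hχ')}) :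
    ∀ (ξ ξ' : OneDimAutRepH L) (a : IrrClass ((cmDatum L 3 H).Local v)),
      a ∈ IrrClass.comap e.symm '' fib (ξ.xiLocalChar v) → a ∈ IrrClass.comap e.symm '' fib (ξ'.xiLocalChar v) → a.IsSupercuspidal →
        ξ.xiLocalChar v = ξ'.xiLocalChar v := by
  intro ξ ξ' a hi hj ha
  obtain ⟨b, hb, rfl⟩ := hi
  obtain ⟨b', hb', hbb⟩ := hj
  cases (fun h => by simpa only [IrrClass.comap_comap_symm] using congrArg (IrrClass.comap e) h : ∀ {x y}, IrrClass.comap e.symm x = IrrClass.comap e.symm y → x = y) hbb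
  exact eq_of_singleton_mk_ofChar_eq _ _ (hγ' _ _ (F0P3XiLocalCharOpenKernel.isOpen_ker_xiLocalChar L ξ v)
    (F0P3XiLocalCharOpenKernel.isOpen_ker_xiLocalChar L ξ' v) b hb hb' ((IrrClass.isSupercuspidal_comap_iff e.symm b).1 ha))

end Laws

/-! ## §3 `hdict` at the pinned record from (J1) (J2) at ONE fixed frame per non-split place -/

section Dictionary

variable (L : Type) [Field L] [NumberField L] [IsCMField L] (H : Matrix (Fin 3) (Fin 3) L)

open scoped Classical in
set_option synthInstance.maxHeartbeats 400000 in
set_option maxHeartbeats 8000000 in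
/-- **THE DICTIONARY `hdict` OF ★ p865005 AT THE PINNED SCD RECORD, FROM TWO FIBRE MEMBERSHIPS (J1) (J2) AT ONE FIXED FRAME PER NON-SPLIT PLACE** (JQ-S9-S4-7
reduced).  Pins: a fixed frame `e₀ v hns := cmDatumLocalCongr L v (T₀ v) (ha₀ v) (h₀ v hns)` at each non-split `v` (★ `exists_congrOfRecordAt` supplies one), S4's fibres
`fib v χ ⊆ Irr(U(Φ₃)(L⁺_v))` of the one-dimensional carriers indexed by the LOCAL characters `χ` of `H_v`, and ANY `supp` with
`a ∈ supp v ξ ↔ comap (e₀ v hns) a ∈ fib v (ξ.xiLocalChar v)` at the non-split places.  Hypotheses (S4-OWNED, Rogawski §12.2 (2) + Prop. 13.1.4 read in the fibre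
currency): (J1) `(keys ξ v hns).1.2 ∈ fib v (ξ.xiLocalChar v)` — Keys' non-tempered label `πⁿ(ξ_v)` lies in the A-fibre of `ℂ_{ξ_v}`; (J2) the SIGNED supercuspidal
partner `((hQS ξ).1 v hns (T₀ v) …).πs` AT THE FIXED FRAME, pulled back along `e₀`, lies there.  Conclusion = ★ `aPacketsOfRecordDisjointAt_recordSCD_of_hQS_of_carrierLaws`'s
`hdict` binder VERBATIM.  The record's own (hidden) frame `T_ξ` is eliminated inside: the `πⁿ` slot by ★ `comap_keysLabelCM_eq` («`πⁿ ∘ e` is intrinsic», needs `hμω`),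
the `πˢ` slot by ★ `eq_packagePis_pair_of_xiLocalChar_eq` at `ξ = ξ′` («the signed partner is frame independent»).
[cite: Rogawski1990, §12.2 (2) pp. 173–174; §13.1 Prop. 13.1.3 (d), Prop. 13.1.4 p. 199; §14.2 p. 234] [cite: BushnellHenniart2006, §1.1] -/
theorem hdict_recordSCD_of_slotsInFibre (hH : (H.map (cmConjRingHom L))ᵀ = H) (hHd : IsUnit H.det) (μω : HeckeCharacter L) (hμu : μω.IsUnitary)
    (hμω : ∀ x : Literature.NumberTheory.GaloisRepresentations.ideleGroup ↥(maximalRealSubfield L),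
      μω (AdeleRing.ideleBaseChange ↥(maximalRealSubfield L) L x) = quadraticHeckeCharCM L x)
    [∀ v : HeightOneSpectrum (𝓞 ↥(maximalRealSubfield L)), MeasurableSpace ((cmDatum L 3 H).Local v)]
    [∀ v : HeightOneSpectrum (𝓞 ↥(maximalRealSubfield L)), BorelSpace ((cmDatum L 3 H).Local v)]
    [∀ v : HeightOneSpectrum (𝓞 ↥(maximalRealSubfield L)),
      MeasurableSpace ((cmDatum L 2 (Matrix.of fun i j : Fin 2 => if i.val + j.val + 1 = 2 then (1 : L) else 0)).Local v ×
        (cmDatum L 1 (Matrix.of fun i j : Fin 1 => if i.val + j.val + 1 = 1 then (1 : L) else 0)).Local v)]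
    [∀ (v : HeightOneSpectrum (𝓞 ↥(maximalRealSubfield L)))
        (a : ((cmDatum L 2 (Matrix.of fun i j : Fin 2 => if i.val + j.val + 1 = 2 then (1 : L) else 0)).Local v ×
          (cmDatum L 1 (Matrix.of fun i j : Fin 1 => if i.val + j.val + 1 = 1 then (1 : L) else 0)).Local v)),
      MeasurableSpace (((cmDatum L 2 (Matrix.of fun i j : Fin 2 => if i.val + j.val + 1 = 2 then (1 : L) else 0)).Local v ×
          (cmDatum L 1 (Matrix.of fun i j : Fin 1 => if i.val + j.val + 1 = 1 then (1 : L) else 0)).Local v) ⧸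
        Subgroup.centralizer ({a} : Set ((cmDatum L 2 (Matrix.of fun i j : Fin 2 => if i.val + j.val + 1 = 2 then (1 : L) else 0)).Local v ×
          (cmDatum L 1 (Matrix.of fun i j : Fin 1 => if i.val + j.val + 1 = 1 then (1 : L) else 0)).Local v)))]
    [∀ (v : HeightOneSpectrum (𝓞 ↥(maximalRealSubfield L))) (γ : (cmDatum L 3 H).Local v),
      MeasurableSpace ((cmDatum L 3 H).Local v ⧸ Subgroup.centralizer ({γ} : Set ((cmDatum L 3 H).Local v)))]
    [∀ v : HeightOneSpectrum (𝓞 ↥(maximalRealSubfield L)), MeasurableSpace (Gqs L v ⧸ Subgroup.center (Gqs L v))]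
    [∀ v : HeightOneSpectrum (𝓞 ↥(maximalRealSubfield L)), BorelSpace (Gqs L v ⧸ Subgroup.center (Gqs L v))]
    {Δ : ∀ v : HeightOneSpectrum (𝓞 ↥(maximalRealSubfield L)), LocalTransferFactor L H v}
    {mH : ∀ v : HeightOneSpectrum (𝓞 ↥(maximalRealSubfield L)),
      OrbitalMeasureFamily ((cmDatum L 2 (Matrix.of fun i j : Fin 2 => if i.val + j.val + 1 = 2 then (1 : L) else 0)).Local v ×
        (cmDatum L 1 (Matrix.of fun i j : Fin 1 => if i.val + j.val + 1 = 1 then (1 : L) else 0)).Local v)}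
    {mG : ∀ v : HeightOneSpectrum (𝓞 ↥(maximalRealSubfield L)), OrbitalMeasureFamily ((cmDatum L 3 H).Local v)}
    {νH : ∀ v : HeightOneSpectrum (𝓞 ↥(maximalRealSubfield L)),
      Measure ((cmDatum L 2 (Matrix.of fun i j : Fin 2 => if i.val + j.val + 1 = 2 then (1 : L) else 0)).Local v ×
        (cmDatum L 1 (Matrix.of fun i j : Fin 1 => if i.val + j.val + 1 = 1 then (1 : L) else 0)).Local v)}
    (νG : ∀ v : HeightOneSpectrum (𝓞 ↥(maximalRealSubfield L)), Measure ((cmDatum L 3 H).Local v))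
    [∀ v : HeightOneSpectrum (𝓞 ↥(maximalRealSubfield L)), (νG v).IsHaarMeasure]
    (μZ : ∀ v : HeightOneSpectrum (𝓞 ↥(maximalRealSubfield L)), Measure (Gqs L v ⧸ Subgroup.center (Gqs L v)))
    [∀ v : HeightOneSpectrum (𝓞 ↥(maximalRealSubfield L)), (μZ v).IsHaarMeasure]
    (keys : ∀ (ξ : OneDimAutRepH L) (v : HeightOneSpectrum (𝓞 ↥(maximalRealSubfield L))),
      (∀ w : PlacesOver L v, IsCMField.complexConj L • w.1 = w.1) →
        {p : IrrClass (Gqs L v) × IrrClass (Gqs L v) //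
          KeysCaseTwoLabels L v (μω.semilocalComponent L v) (torusLocalComponent L (IsCMField.complexConj L) v ξ.η)
            (torusLocalComponent L (IsCMField.complexConj L) v ξ.ψ) p.1 p.2 ∧
          p.1.IsSquareIntegrable (μZ v) ∧ ¬ p.2.IsSquareIntegrable (μZ v)})
    (hQS : CMCharIdentityPackageTestSigned L H hH hHd νH νG μω hμu Δ mH mG)
    (hex : ∀ v : HeightOneSpectrum (𝓞 ↥(maximalRealSubfield L)), (∀ w : PlacesOver L v, IsCMField.complexConj L • w.1 = w.1) →
      IsLocalDeltaTransferExists L H v (Δ v) (mH v) (mG v) IsLocSmooth IsLocSmooth)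
    -- ONE fixed frame per non-split place (★ `exists_congrOfRecordAt` supplies one)
    (T₀ : ∀ v : HeightOneSpectrum (𝓞 ↥(maximalRealSubfield L)), GL (Fin 3) (LocalRing L v))
    (a₀ : ∀ v : HeightOneSpectrum (𝓞 ↥(maximalRealSubfield L)), LocalRing L v) (ha₀ : ∀ v, IsUnit (a₀ v))
    (h₀ : ∀ v : HeightOneSpectrum (𝓞 ↥(maximalRealSubfield L)), (∀ w : PlacesOver L v, IsCMField.complexConj L • w.1 = w.1) →
      formCongr (conjLocal L (IsCMField.complexConj L) v) (T₀ v) (H.map (algebraMap L (LocalRing L v))) =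
        a₀ v • (Matrix.of fun i j : Fin 3 => if i.val + j.val + 1 = 3 then (1 : L) else 0).map (algebraMap L (LocalRing L v)))
    -- S4's fibres of the one-dimensional carriers on `U(Φ₃)(L⁺_v)`, indexed by LOCAL characters of `H_v`
    (fib : ∀ v : HeightOneSpectrum (𝓞 ↥(maximalRealSubfield L)),
      ((cmDatum L 2 (Matrix.of fun i j : Fin 2 => if i.val + j.val + 1 = 2 then (1 : L) else 0)).Local v ×
        (cmDatum L 1 (Matrix.of fun i j : Fin 1 => if i.val + j.val + 1 = 1 then (1 : L) else 0)).Local v →* ℂˣ) → Set (IrrClass (Gqs L v)))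
    -- B's pin of `supp` (any definition with this characterization at the non-split places)
    (supp : ∀ v : HeightOneSpectrum (𝓞 ↥(maximalRealSubfield L)), OneDimAutRepH L → Set (IrrClass ((cmDatum L 3 H).Local v)))
    (hsupp : ∀ (v : HeightOneSpectrum (𝓞 ↥(maximalRealSubfield L))) (hns : ∀ w : PlacesOver L v, IsCMField.complexConj L • w.1 = w.1) (ξ : OneDimAutRepH L) a,
      a ∈ supp v ξ ↔ IrrClass.comap (cmDatumLocalCongr L v (T₀ v) (ha₀ v) (h₀ v hns)) a ∈ fib v (ξ.xiLocalChar v))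
    -- (J1) Keys' `πⁿ` label lies in the fibre
    (hJ1 : ∀ (ξ : OneDimAutRepH L) (v : HeightOneSpectrum (𝓞 ↥(maximalRealSubfield L))) (hns : ∀ w : PlacesOver L v, IsCMField.complexConj L • w.1 = w.1),
      (keys ξ v hns).1.2 ∈ fib v (ξ.xiLocalChar v))
    -- (J2) the signed supercuspidal partner at the fixed frame, pulled back to `U(Φ₃)`, lies in the fibre
    (hJ2 : ∀ (ξ : OneDimAutRepH L) (v : HeightOneSpectrum (𝓞 ↥(maximalRealSubfield L))) (hns : ∀ w : PlacesOver L v, IsCMField.complexConj L • w.1 = w.1),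
      IrrClass.comap (cmDatumLocalCongr L v (T₀ v) (ha₀ v) (h₀ v hns))
        ((hQS ξ).1 v hns (T₀ v) (a₀ v) (ha₀ v) (h₀ v hns) (μZ v) (keys ξ v hns).1.1 (keys ξ v hns).1.2 (keys ξ v hns).2.1 (keys ξ v hns).2.2.2).πs
        ∈ fib v (ξ.xiLocalChar v)) :
    ∀ v : HeightOneSpectrum (𝓞 ↥(maximalRealSubfield L)), (∀ w : PlacesOver L v, IsCMField.complexConj L • w.1 = w.1) → ∀ ξ,
      (xiPacketFamilyOfRecordSCD L H hH hHd μω hμu μZ keys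
          (hSCD_of_cmCharIdentityPackageTestSigned L H hH hHd μω hμu Δ mH mG νG νH μZ hQS) ξ v).πn ∈ supp v ξ ∧
        ∀ c, (xiPacketFamilyOfRecordSCD L H hH hHd μω hμu μZ keys
          (hSCD_of_cmCharIdentityPackageTestSigned L H hH hHd μω hμu Δ mH mG νG νH μZ hQS) ξ v).πs = some c → c ∈ supp v ξ := by
  intro v hns ξ
  obtain ⟨T, a, ha, h, hP, -⟩ := xiPacketFamilyOfRecordSCD_of_nonsplit L H hH hHd μω hμu μZ keys
    (hSCD_of_cmCharIdentityPackageTestSigned L H hH hHd μω hμu Δ mH mG νG νH μZ hQS) ξ v hns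
  rw [hP]
  refine ⟨?_, fun c hc => ?_⟩
  · -- the `πⁿ` slot: frame independence of the transported Keys label, then (J1)
    rw [hsupp v hns]
    change IrrClass.comap (cmDatumLocalCongr L v (T₀ v) (ha₀ v) (h₀ v hns))
        (IrrClass.comap (cmDatumLocalCongr L v T ha h).symm (keys ξ v hns).1.2) ∈ fib v (ξ.xiLocalChar v)
    rw [F0P3cDbTKeysLabelRigidity.comap_keysLabelCM_eq hH μω hμω ξ hns T (T₀ v) ha (ha₀ v) h (h₀ v hns) (μZ v) (μZ v)
      (keys ξ v hns).2.1 (keys ξ v hns).2.1 (keys ξ v hns).2.2.2 (keys ξ v hns).2.2.2, IrrClass.comap_comap_symm]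
    exact hJ1 ξ v hns
  · -- the `πˢ` slot: the signed partner is frame independent (★ p864969 §4 at `ξ = ξ′`), then (J2)
    simp only [Option.some.injEq] at hc
    subst hc
    rw [hsupp v hns]
    obtain ⟨-, -, hπs⟩ := eq_packagePis_pair_of_xiLocalChar_eq L H hH hHd νG hQS ξ ξ v hns rfl (hex v hns) T a ha h (T₀ v) (a₀ v) (ha₀ v) (h₀ v hns) (μZ v)
      (keys ξ v hns).1.1 (keys ξ v hns).1.2 (keys ξ v hns).2.1 (keys ξ v hns).2.2.2
      (keys ξ v hns).1.1 (keys ξ v hns).1.2 (keys ξ v hns).2.1 (keys ξ v hns).2.2.2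
    change IrrClass.comap (cmDatumLocalCongr L v (T₀ v) (ha₀ v) (h₀ v hns))
        ((hQS ξ).1 v hns T a ha h (μZ v) (keys ξ v hns).1.1 (keys ξ v hns).1.2 (keys ξ v hns).2.1 (keys ξ v hns).2.2.2).πs ∈ fib v (ξ.xiLocalChar v)
    rw [hπs]
    exact hJ2 ξ v hns


end Dictionary

end Summit.HodgeConjecture.HodgeConjecture.R90.S9

end
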